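import Mathlib
import Summits.KontsevichZagierPeriods.Zeta5Search.BigPrimeDivisibility
import Summits.KontsevichZagierPeriods.Zeta5Search.WedgeDictionaryInstances
import HarnessLib

/-!
# ζ(5) search — a kernel instance of the big-prime divisibility theorem: `b = (3; 0,…,0)`

Cell `pub-zeta5` (HONEST FRAMING: systematic search; no irrationality claim unless certified), typer seat
generation 7.  A SANITY INSTANCE of (W∞)/(U∞) (`BigPrimeDivisibility.lean`) with every number in the kernel:
for the toy parameter `b = (3; 0⁷)` (`d(b) = 9`, window `max(5, b₀+1) = 5 ≤ p ≤ 10`) the summand is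
`R(t) = (2t+5)/((t+1)(t+2)(t+3)(t+4))^6`, its partial-fraction table `cToy` is certified (`isPFData_bToy`), and
`W(3;0⁷) = −22505/209952 = −5·7·643/(2⁵·3⁸)`, `U(3;0⁷) = −95/2916 = −5·19/(2²·3⁶)`.  So `5, 7 ∣ W` and `5 ∣ U`
— once by the THEOREM (hypotheses discharged by `decide`: they are jointly satisfiable, the theorem is not vacuous)
and once by explicit arithmetic (third implementation of these two numbers: the typer's exact prototype and gen-2's
engine agree: REPORT-gen2-g5 §5e toy family, `((n−1)!)⁶·W = S_n`, `S_4 = −45010/9`).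
-/

noncomputable section

open Finset Polynomial

namespace Summit.KontsevichZagierPeriods.Zeta5Search.BigPrime

open Summit.KontsevichZagierPeriods.Zeta5Search.DualSeries (InBox numPoly eval_numPoly)
open Summit.KontsevichZagierPeriods.Zeta5Search.WedgeDictionary (IsPFData coeffU coeffW coeffU_eq coeffW_eq dOf
  poch_four)
open Literature.NumberTheory.Transcendental.BallRivoal (pfEval poch)

/-- The toy parameter `b = (3; 0,0,0,0,0,0,0)`. -/
def bToy : ℕ → ℤ := fun j => if j = 0 then 3 else 0

/-- The partial-fraction table of `R_{(3;0⁷)}(t) = (2t+5)/((t+1)(t+2)(t+3)(t+4))^6` (`cToy o q` = coefficient of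
`(t+q+1)^{−(o+1)}`; computed exactly, certified below). -/
def cToy : ℕ → ℕ → ℚ := fun o q =>
  if o = 0 then (if q = 0 then -63/512 else if q = 1 then 63/512 else if q = 2 then 63/512 else if q = 3 then -63/512 else 0) else
  if o = 1 then (if q = 0 then 462163/10077696 else if q = 1 then 83/512 else if q = 2 then -83/512
    else if q = 3 then -462163/10077696 else 0) else
  if o = 2 then (if q = 0 then -12205/839808 else if q = 1 then -5/128 else if q = 2 then -5/128
    else if q = 3 then -12205/839808 else 0) else
  if o = 3 then (if q = 0 then 229/62208 else if q = 1 then 21/256 else if q = 2 then -21/256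
    else if q = 3 then -229/62208 else 0) else
  if o = 4 then (if q = 0 then -31/46656 else if q = 1 then -1/64 else if q = 2 then -1/64
    else if q = 3 then -31/46656 else 0) else
  if o = 5 then (if q = 0 then 1/15552 else if q = 1 then 1/64 else if q = 2 then -1/64
    else if q = 3 then -1/15552 else 0) else 0

/-- `numPoly_{(3;0⁷)}(t+1) = 2t + 5` (all fourteen Pochhammer factors are empty). -/
theorem eval_numPoly_bToy (t : ℚ) : ((numPoly bToy).comp (X + C 1)).eval t = 2 * t + 5 := by
  rw [eval_comp, eval_add, eval_X, eval_C, eval_numPoly]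
  simp [bToy, Literature.NumberTheory.Transcendental.BallRivoal.poch]
  ring

/-- `cToy` IS the partial-fraction data of `R_{(3;0⁷)}`. -/
theorem isPFData_bToy : IsPFData bToy cToy := by
  intro t ht
  have hB : (bToy 0).toNat = 3 := by decide
  rw [hB] at ht ⊢
  have h1 : t + 1 ≠ 0 := by have := ht 0 (by norm_num); simpa using this
  have h2 : t + 2 ≠ 0 := by have := ht 1 (by norm_num); intro h; apply this; push_cast; linarith
  have h3 : t + 3 ≠ 0 := by have := ht 2 (by norm_num); intro h; apply this; push_cast; linarith
  have h4 : t + 4 ≠ 0 := by have := ht 3 (by norm_num); intro h; apply this; push_cast; linarith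
  rw [eval_numPoly_bToy, poch_four]
  simp only [pfEval, sum_range_succ, sum_range_zero, cToy]
  norm_num
  rw [show t + 1 + 1 = t + 2 by ring, show t + 2 + 1 = t + 3 by ring, show t + 3 + 1 = t + 4 by ring]
  field_simp
  ring

/-- `W(3;0⁷) = −22505/209952 = −5·7·643/(2⁵·3⁸)`. -/
theorem coeffW_bToy : coeffW bToy = -22505 / 209952 := by
  rw [coeffW_eq isPFData_bToy, show (bToy 0).toNat = 3 by decide]
  simp only [sum_range_succ, sum_range_zero, cToy]
  norm_num

/-- `U(3;0⁷) = −95/2916 = −5·19/(2²·3⁶)`. -/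
theorem coeffU_bToy : coeffU bToy = -95 / 2916 := by
  rw [coeffU_eq isPFData_bToy, show (bToy 0).toNat = 3 by decide]
  simp only [sum_range_succ, sum_range_zero, cToy]
  norm_num

/-- The theorem's hypotheses at the toy parameter: in the box, in the polytope, `d = 9`. -/
theorem bToy_hyps : InBox bToy ∧ (∀ i ∈ range 7, 2 * bToy (i + 1) ≤ bToy 0) ∧
    (∑ i ∈ range 7, bToy (i + 1) ≤ 3 * bToy 0) ∧ dOf bToy = 9 := by
  refine ⟨?_, ?_, ?_, ?_⟩
  · unfold InBox; decide
  · decide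
  · decide
  · decide

/-- **(W∞) at the toy parameter, BY THE THEOREM**: `v₅(W(3;0⁷)) ≥ 1` and `v₇(W(3;0⁷)) ≥ 1` (window `5 ≤ p ≤ 10`);
**(U∞)**: `v₅(U(3;0⁷)) ≥ 1` (`2·5 ≤ 10`).  All hypotheses discharged by `decide` — they are jointly satisfiable. -/
theorem toy_by_theorem : 1 ≤ padicValRat 5 (coeffW bToy) ∧ 1 ≤ padicValRat 7 (coeffW bToy) ∧
    1 ≤ padicValRat 5 (coeffU bToy) := by
  obtain ⟨hb, h2, h3, hd⟩ := bToy_hyps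
  have hW0 : coeffW bToy ≠ 0 := by rw [coeffW_bToy]; norm_num
  have hU0 : coeffU bToy ≠ 0 := by rw [coeffU_bToy]; norm_num
  have hb0 : bToy 0 = 3 := by decide
  refine ⟨one_le_padicValRat_coeffW bToy 5 hb h2 h3 (by norm_num) le_rfl (by rw [hb0]; norm_num)
      (by rw [hd]; norm_num) hW0,
    one_le_padicValRat_coeffW bToy 7 hb h2 h3 (by norm_num) (by norm_num) (by rw [hb0]; norm_num)
      (by rw [hd]; norm_num) hW0,
    one_le_padicValRat_coeffU bToy 5 hb h2 h3 (by norm_num) le_rfl (by rw [hb0]; norm_num)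
      (by rw [hd]; norm_num) hU0⟩

/-- **The same BY ARITHMETIC** (cross-check of the values): `v₅(−22505/209952) = 1`, `v₇(−22505/209952) = 1`,
`v₅(−95/2916) = 1`. -/
theorem toy_by_arithmetic : padicValRat 5 (coeffW bToy) = 1 ∧ padicValRat 7 (coeffW bToy) = 1 ∧
    padicValRat 5 (coeffU bToy) = 1 := by
  have h5 : Fact (Nat.Prime 5) := ⟨by norm_num⟩
  have h7 : Fact (Nat.Prime 7) := ⟨by norm_num⟩
  rw [coeffW_bToy, coeffU_bToy]
  refine ⟨?_, ?_, ?_⟩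
  · rw [show (-22505 / 209952 : ℚ) = -(((22505 : ℕ) : ℚ) / ((209952 : ℕ) : ℚ)) by norm_num, padicValRat.neg,
      padicValRat.div (by norm_num) (by norm_num), padicValRat.of_nat, padicValRat.of_nat,
      show (22505 : ℕ) = 5 * 4501 by norm_num, padicValNat.mul (by norm_num) (by norm_num), padicValNat.self (by norm_num),
      padicValNat.eq_zero_of_not_dvd (show ¬ 5 ∣ 4501 by norm_num),
      padicValNat.eq_zero_of_not_dvd (show ¬ 5 ∣ 209952 by norm_num)]
    norm_num
  · rw [show (-22505 / 209952 : ℚ) = -(((22505 : ℕ) : ℚ) / ((209952 : ℕ) : ℚ)) by norm_num, padicValRat.neg,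
      padicValRat.div (by norm_num) (by norm_num), padicValRat.of_nat, padicValRat.of_nat,
      show (22505 : ℕ) = 7 * 3215 by norm_num, padicValNat.mul (by norm_num) (by norm_num), padicValNat.self (by norm_num),
      padicValNat.eq_zero_of_not_dvd (show ¬ 7 ∣ 3215 by norm_num),
      padicValNat.eq_zero_of_not_dvd (show ¬ 7 ∣ 209952 by norm_num)]
    norm_num
  · rw [show (-95 / 2916 : ℚ) = -(((95 : ℕ) : ℚ) / ((2916 : ℕ) : ℚ)) by norm_num, padicValRat.neg,
      padicValRat.div (by norm_num) (by norm_num), padicValRat.of_nat, padicValRat.of_nat,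
      show (95 : ℕ) = 5 * 19 by norm_num, padicValNat.mul (by norm_num) (by norm_num), padicValNat.self (by norm_num),
      padicValNat.eq_zero_of_not_dvd (show ¬ 5 ∣ 19 by norm_num),
      padicValNat.eq_zero_of_not_dvd (show ¬ 5 ∣ 2916 by norm_num)]
    norm_num

end Summit.KontsevichZagierPeriods.Zeta5Search.BigPrime

end
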